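import Summits.CriticalPhenomena.CardyFormulaZ2.Theorems.CardyIKTransportIKMixedBoxCrossingQuenchedVarianceDefs

/-!
# Telescoping bound `E ∏ Xᵢ ≥ ∏ pᵢ − Σᵢ √E(Xᵢ − pᵢ)²` (line `defect-closure-exploration` v8 / ALT line `quenched-chain-fkg`,
# crux `IKMixedBoxCrossing`, stmt-CriticalPhenomena-5911)

Support file (`--supports stmt-CriticalPhenomena-5911`, registered helper stub `telescoping_sqrt_bound`) for the stub
`stub_approxHarrisFamOfVariance` (F) of `…QuenchedVarianceDefs`: the PURE FINITE-SUM inequality behind "Harris up to the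
environment standard deviations".  For probability weights `π` on a finite index set `T`, functions `X i : T → [0, 1]`
(`i < k`) and ANY centres `p i ∈ [0, 1]`,

  `∑_j π j ∏_i X i j ≥ ∏_i p i − ∑_i √(∑_j π j (X i j − p i)²)`.

Proof: peel off the first factor (`Fin.prod_univ_succ`), `X₀ Y = p₀ Y + (X₀ − p₀) Y ≥ p₀ Y − |X₀ − p₀|` for `Y ∈ [0, 1]`,
induct (`sum_prod_sub_le`), and bound each mean absolute deviation by the root mean square (Cauchy–Schwarz,
`Finset.sum_mul_sq_le_sq_mul_sq`).  No percolation, no new definitions.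
-/

noncomputable section

namespace Summit.CriticalPhenomena.CardyFormulaZ2.Cruxes.IKMixedBoxCrossing.QuenchedChainFKG

open scoped BigOperators
open Finset

namespace Telescoping

/-- Mean absolute deviation ≤ root mean square deviation, for nonnegative weights of total mass one (Cauchy–Schwarz). -/
theorem sum_mul_abs_le_sqrt {ι : Type*} (T : Finset ι) (π d : ι → ℝ) (hπ : ∀ j ∈ T, 0 ≤ π j)
    (hπ1 : ∑ j ∈ T, π j = 1) : ∑ j ∈ T, π j * |d j| ≤ Real.sqrt (∑ j ∈ T, π j * d j ^ 2) := by
  have h := Finset.sum_mul_sq_le_sq_mul_sq T (fun j => Real.sqrt (π j)) (fun j => Real.sqrt (π j) * |d j|)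
  have e1 : ∀ j ∈ T, Real.sqrt (π j) * (Real.sqrt (π j) * |d j|) = π j * |d j| := fun j hj => by
    rw [← mul_assoc, Real.mul_self_sqrt (hπ j hj)]
  have e2 : ∀ j ∈ T, Real.sqrt (π j) ^ 2 = π j := fun j hj => Real.sq_sqrt (hπ j hj)
  have e3 : ∀ j ∈ T, (Real.sqrt (π j) * |d j|) ^ 2 = π j * d j ^ 2 := fun j hj => by
    rw [mul_pow, Real.sq_sqrt (hπ j hj), sq_abs]
  rw [Finset.sum_congr rfl e1, Finset.sum_congr rfl e2, Finset.sum_congr rfl e3, hπ1, one_mul] at h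
  have h0 : 0 ≤ ∑ j ∈ T, π j * |d j| := Finset.sum_nonneg fun j hj => mul_nonneg (hπ j hj) (abs_nonneg _)
  calc ∑ j ∈ T, π j * |d j| = Real.sqrt ((∑ j ∈ T, π j * |d j|) ^ 2) := (Real.sqrt_sq h0).symm
    _ ≤ Real.sqrt (∑ j ∈ T, π j * d j ^ 2) := Real.sqrt_le_sqrt h

/-- A product of factors in `[0, 1]` lies in `[0, 1]`. -/
theorem prod_mem_unit {ι : Type*} {k : ℕ} (X : Fin k → ι → ℝ) {j : ι} (hX : ∀ i, 0 ≤ X i j ∧ X i j ≤ 1) :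
    0 ≤ ∏ i, X i j ∧ ∏ i, X i j ≤ 1 :=
  ⟨Finset.prod_nonneg fun i _ => (hX i).1, Finset.prod_le_one (fun i _ => (hX i).1) fun i _ => (hX i).2⟩

/-- THE TELESCOPING STEP, mean-absolute-deviation form:
`∑_j π j ∏_i X i j ≥ ∏_i p i − ∑_i ∑_j π j |X i j − p i|` (induction on the number of factors). -/
theorem sum_prod_sub_le : ∀ (k : ℕ) {ι : Type*} (T : Finset ι) (π : ι → ℝ), (∀ j ∈ T, 0 ≤ π j) →
    ∑ j ∈ T, π j = 1 → ∀ (X : Fin k → ι → ℝ) (p : Fin k → ℝ), (∀ i, ∀ j ∈ T, 0 ≤ X i j ∧ X i j ≤ 1) →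
      (∀ i, 0 ≤ p i ∧ p i ≤ 1) →
        (∏ i, p i) - ∑ i, ∑ j ∈ T, π j * |X i j - p i| ≤ ∑ j ∈ T, π j * ∏ i, X i j := by
  intro k
  induction k with
  | zero =>
    intro ι T π _ hπ1 X p _ _
    simp [hπ1]
  | succ k ih =>
    intro ι T π hπ hπ1 X p hX hp
    have hIH := ih T π hπ hπ1 (fun i => X i.succ) (fun i => p i.succ) (fun i => hX i.succ) fun i => hp i.succ
    simp only [Fin.prod_univ_succ, Fin.sum_univ_succ]
    -- the first factor: `X₀ Y = p₀ Y + (X₀ - p₀) Y ≥ p₀ Y - |X₀ - p₀|`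
    have hstep : ∀ j ∈ T, π j * (p 0 * ∏ i : Fin k, X i.succ j) - π j * |X 0 j - p 0| ≤
        π j * (X 0 j * ∏ i : Fin k, X i.succ j) := by
      intro j hj
      obtain ⟨hY0, hY1⟩ := prod_mem_unit (fun i => X i.succ) fun i => hX i.succ j hj
      have h1 : -|X 0 j - p 0| ≤ (X 0 j - p 0) * ∏ i : Fin k, X i.succ j := by
        have h2 : |(X 0 j - p 0) * ∏ i : Fin k, X i.succ j| ≤ |X 0 j - p 0| := by
          rw [abs_mul, abs_of_nonneg hY0]
          exact mul_le_of_le_one_right (abs_nonneg _) hY1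
        linarith [neg_abs_le ((X 0 j - p 0) * ∏ i : Fin k, X i.succ j)]
      have h3 : π j * (-|X 0 j - p 0|) ≤ π j * ((X 0 j - p 0) * ∏ i : Fin k, X i.succ j) :=
        mul_le_mul_of_nonneg_left h1 (hπ j hj)
      nlinarith [h3]
    have hsum : (∑ j ∈ T, π j * (p 0 * ∏ i : Fin k, X i.succ j)) - ∑ j ∈ T, π j * |X 0 j - p 0| ≤
        ∑ j ∈ T, π j * (X 0 j * ∏ i : Fin k, X i.succ j) := by
      rw [← Finset.sum_sub_distrib]
      exact Finset.sum_le_sum hstep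
    have hfac : ∑ j ∈ T, π j * (p 0 * ∏ i : Fin k, X i.succ j) = p 0 * ∑ j ∈ T, π j * ∏ i : Fin k, X i.succ j := by
      rw [Finset.mul_sum]
      exact Finset.sum_congr rfl fun j _ => by ring
    have he : 0 ≤ ∑ i : Fin k, ∑ j ∈ T, π j * |X i.succ j - p i.succ| :=
      Finset.sum_nonneg fun i _ => Finset.sum_nonneg fun j hj => mul_nonneg (hπ j hj) (abs_nonneg _)
    have hp0 := hp 0
    nlinarith [mul_le_mul_of_nonneg_left hIH hp0.1, hsum, hfac, he, hp0.2]

end Telescoping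

open Telescoping in
/-- **Registered helper stub `telescoping_sqrt_bound`** (the finite-sum inequality behind (F)): for probability weights `π`
on `T`, `[0, 1]`-valued `X i` and centres `p i ∈ [0, 1]`,
`∏_i p i − ∑_i √(∑_j π j (X i j − p i)²) ≤ ∑_j π j ∏_i X i j`. -/
theorem telescoping_sqrt_bound : ∀ {ι : Type*} (T : Finset ι) (π : ι → ℝ), (∀ j ∈ T, 0 ≤ π j) → ∑ j ∈ T, π j = 1 →
    ∀ (k : ℕ) (X : Fin k → ι → ℝ) (p : Fin k → ℝ), (∀ i, ∀ j ∈ T, 0 ≤ X i j ∧ X i j ≤ 1) →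
      (∀ i, 0 ≤ p i ∧ p i ≤ 1) →
        (∏ i, p i) - ∑ i, Real.sqrt (∑ j ∈ T, π j * (X i j - p i) ^ 2) ≤ ∑ j ∈ T, π j * ∏ i, X i j := by
  intro ι T π hπ hπ1 k X p hX hp
  have h1 := sum_prod_sub_le k T π hπ hπ1 X p hX hp
  have h2 : ∑ i, ∑ j ∈ T, π j * |X i j - p i| ≤ ∑ i, Real.sqrt (∑ j ∈ T, π j * (X i j - p i) ^ 2) :=
    Finset.sum_le_sum fun i _ => sum_mul_abs_le_sqrt T π (fun j => X i j - p i) hπ hπ1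
  linarith

end Summit.CriticalPhenomena.CardyFormulaZ2.Cruxes.IKMixedBoxCrossing.QuenchedChainFKG

end
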